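import Summits.ABC.ABC.Theorems.IsogenyGlueCongruenceMazurKenkuBoundStubPotGoodTwoAux
import HarnessLib

/-!
# Route `IsogenyGlueCongruence`, crux `MazurKenkuBound` (stmt-ABC-15125) — line `Sketch`,
# stub `stub_potGoodTwo`: `‖q‖₂ ≤ 1` at a potentially good additive prime `2` (the assembly)

The registered stub `stub_potGoodTwo` of the skeleton of lead c19: for the data of Edixhoven's
integrality `edixhoven_int_of_neronLattice_eq_smul_periodLattice` (a globally minimal `W'/ℚ`
with newform `f`, a Néron period pair `L'` with `Λ_{L'} = q · Λ_f` exactly) at an ADDITIVE prime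
`2` (`2 ∣ Δ_min`, `2 ∣ c₄`) of POTENTIALLY GOOD reduction (`‖j‖₂ ≤ 1`), granted the two
pure-algebra inputs of the wave as hypotheses —

* the flex normal form (`stub_flexAlgebra`): from a root `x₀` of `Ψ₃`, a point `(x₀, y₀)` and
  the tangent slope `s`, `(1, x₀, s, y₀) • W = (A₁, 0, A₃, 0, 0)`, i.e. `y² + A₁xy + A₃y = x³`;
* the flex inequalities (`stub_flexNorms`): `‖A₁‖¹² ≤ ‖Δ‖`, `‖A₃‖⁴ = ‖Δ‖` when `‖c₄‖³ ≤ ‖Δ‖`,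
  and `‖A₁‖⁴ = ‖c₄‖` when moreover `‖Δ‖ ≤ 2⁻¹⁶`, `‖c₄‖ ≥ 2⁻⁷` —

we prove `‖q‖₂ ≤ 1`. The proof imitates `exists_nodalTwist_of_one_lt_norm_j`
(`ManinConstantPotMultiplicativeProofs`) step for step: over `K = ℚ₂(x₀, y₀, u₁)`,
`u₁¹² = Δ(W')`, with ring of integers `O = padicCoeffRing K`, uniformiser `ϖ` (`‖ϖ‖ᵉ = 1/2`)
and `u₁ = wϖᵏ` (`12k = v₂(Δ)e`), the `O`-curve `V'' = (ϖᵏ, x₀, s, y₀) • (W' ⊗ K) = (α, 0, β, 0, 0)`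
has `β ∈ O^×` (`‖A₃‖ = ‖u₁‖³`), so `coeff 4 [2]_{V''} = −7β` is a unit
(`coeff_four_formalMul_two`, `J = 4`). If `v₂(Δ_min) ≤ 15` then `3k < 4e` and the sharp ender
`padicNorm_le_one_of_neronLattice_eq_smul_periodLattice_of_semistableTwist_sharp` concludes; if
`v₂(Δ_min) ≥ 16` then Kraus (`not_pow_dvd_c₄_minimalDiscriminantInt_two`) gives `v₂(c₄) ≤ 7`,
hence `‖A₁‖⁴ = ‖c₄‖`, `α = unit · ϖᵛ` with `4(k + v) = v₂(c₄)e < 8e`, and the vertex ender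
`…_semistableTwist_vertex` with `(j, v) = (2, v)` (`coeff 2 [2]_{V''} = −α`,
`coeff_two_formalMul_two`) concludes.

The elementary inputs (the `2`-integral flex point `exists_flexPoint_padicAlgCl_two`, the
ultrametric root bound, the flex invariants `Δ = A₃³(A₁³ − 27A₃)`, `c₄ = A₁(A₁³ − 24A₃)`, the
scaling rules, `‖j‖ ≤ 1 ⇒ ‖c₄‖³ ≤ ‖Δ‖`, Kraus `v₂(Δ_min) ≥ 16 ⇒ v₂(c₄) ≤ 7`) are part 1,
`IsogenyGlueCongruenceMazurKenkuBoundStubPotGoodTwoAux.lean`.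

## References

* B. Edixhoven, *On the Manin constants of modular elliptic curves*, in: Arithmetic algebraic
  geometry (Texel, 1989), Progr. Math. 89 (1991), Prop. 2. [EdixhovenManin1991]
* J. H. Silverman, *The Arithmetic of Elliptic Curves*, 2nd ed. (2009), III.1, IV.2.3, VII.5.5.
  [SilvermanAEC2009]
-/

-- `Summit.<Summit>.<Problem>` is the mandated summit-side namespace (CONVENTIONS §2); for the
-- single-conjunct summit `ABC` the two coincide, so the duplicate `ABC.ABC` is deliberate.
set_option linter.dupNamespace false

noncomputable section

open scoped MatrixGroups ModularForm

open CongruenceSubgroup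
open WeierstrassCurve
open PowerSeries
open Literature.NumberTheory.EllipticCurves
open Literature.NumberTheory.EllipticCurves.ModularForms
open Literature.NumberTheory.GaloisRepresentations
open Literature.NumberTheory.Automorphic

namespace Summit.ABC.ABC.Theorems

set_option maxHeartbeats 4000000 in
/-- **`‖q‖₂ ≤ 1` for the data of Edixhoven's fact at an additive `2` with `‖j‖₂ ≤ 1`** (the
registered stub `stub_potGoodTwo` of crux stmt-ABC-15125, line `Sketch`), granted the flex normal
form and the flex inequalities (the first two hypotheses, at `Type 0`). Over
`K = ℚ₂(x₀, y₀, u₁)`, `u₁¹² = Δ(W')`, the flex model twisted by `u₁` (unit-adjusted to `u = ϖᵏ`)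
is an `𝒪_K`-curve `V'' = (α, 0, β, 0, 0)` with `β ∈ 𝒪_K^×`, so `coeff 4 [2]_{V''} = −7β` is a
unit; with `12k = v₂(Δ)·e`: `…_semistableTwist_sharp` (`J = 4`) when `v₂(Δ_min) ≤ 15`, and
`…_semistableTwist_vertex` with `(j, v) = (2, v_K(α))`, `coeff 2 [2] = −α`, `‖A₁‖⁴ = ‖c₄‖`,
`v₂(c₄) ≤ 7` (Kraus) when `v₂(Δ_min) ≥ 16`.
[cite: EdixhovenManin1991, Prop. 2] [cite: SilvermanAEC2009, VII.5.5] -/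
theorem stub_potGoodTwo :
    (∀ {F : Type} [Field F] [CharZero F] (W : WeierstrassCurve F) (x₀ y₀ : F), W.Δ ≠ 0 →
      y₀ ^ 2 + W.a₁ * x₀ * y₀ + W.a₃ * y₀ = x₀ ^ 3 + W.a₂ * x₀ ^ 2 + W.a₄ * x₀ + W.a₆ →
      3 * x₀ ^ 4 + W.b₂ * x₀ ^ 3 + 3 * W.b₄ * x₀ ^ 2 + 3 * W.b₆ * x₀ + W.b₈ = 0 →
      2 * y₀ + W.a₁ * x₀ + W.a₃ ≠ 0 ∧
      ∃ s : F, s ^ 2 + W.a₁ * s - W.a₂ - 3 * x₀ = 0 ∧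
        ((⟨1, x₀, s, y₀⟩ : VariableChange F) • W).a₂ = 0 ∧
        ((⟨1, x₀, s, y₀⟩ : VariableChange F) • W).a₄ = 0 ∧
        ((⟨1, x₀, s, y₀⟩ : VariableChange F) • W).a₆ = 0) →
    (∀ {F : Type} [NormedField F] [IsUltrametricDist F], ‖(2 : F)‖ = 2⁻¹ → ‖(3 : F)‖ = 1 →
      ∀ (A₁ A₃ : F), ‖A₁‖ ≤ 1 → ‖A₃‖ ≤ 1 → A₃ ^ 3 * (A₁ ^ 3 - 27 * A₃) ≠ 0 →
      ‖A₁ * (A₁ ^ 3 - 24 * A₃)‖ ^ 3 ≤ ‖A₃ ^ 3 * (A₁ ^ 3 - 27 * A₃)‖ →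
      (‖A₁‖ ^ 12 ≤ ‖A₃ ^ 3 * (A₁ ^ 3 - 27 * A₃)‖ ∧ ‖A₃‖ ^ 4 = ‖A₃ ^ 3 * (A₁ ^ 3 - 27 * A₃)‖) ∧
      (‖A₃ ^ 3 * (A₁ ^ 3 - 27 * A₃)‖ ≤ 2⁻¹ ^ 16 → 2⁻¹ ^ 7 ≤ ‖A₁ * (A₁ ^ 3 - 24 * A₃)‖ →
        ‖A₁‖ ^ 4 = ‖A₁ * (A₁ ^ 3 - 24 * A₃)‖)) →
    ∀ {N : ℕ} [NeZero N] {W' : WeierstrassCurve ℚ} [W'.IsElliptic] [W'.IsGloballyMinimal]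
      {f : CuspForm (Gamma0 N) 2} {L' : PeriodPair}, IsNewformOf W' f →
      IsNeronLatticeOf (W'.baseChange ℂ) L' → ∀ {q : ℚ},
      (∀ z ∈ periodLattice f, (q : ℂ) * z ∈ L'.lattice) →
      (∀ z ∈ L'.lattice, ∃ w ∈ periodLattice f, z = q * w) →
      (2 : ℤ) ∣ minimalDiscriminantInt W' → (2 : ℤ) ∣ (integralModelInt W').c₄ →
      ‖((W'.j : ℚ) : ℚ_[2])‖ ≤ 1 → ‖(q : ℚ_[2])‖ ≤ 1 := by
  intro hAlg hNorm N _ W' _ _ f L' hf hL' q hq hq' hΔ hc₄ hj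
  classical
  /- Step 0: the invariants of `W'` over `ℚ` and their `2`-adic norms. -/
  have hΔ0 : W'.Δ ≠ 0 := W'.isUnit_Δ.ne_zero
  set d : ℕ := padicValInt 2 (minimalDiscriminantInt W') with hd_def
  have hnΔ : ‖((W'.Δ : ℚ) : ℚ_[2])‖ = ((2 : ℝ)⁻¹) ^ d := by
    have h := norm_Δ_eq_inv_pow_padicValInt W' (p := 2)
    push_cast at h
    exact h
  have hpot : ‖((W'.c₄ : ℚ) : ℚ_[2])‖ ^ 3 ≤ ‖((W'.Δ : ℚ) : ℚ_[2])‖ :=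
    norm_c₄_pow_three_le_norm_Δ W' hj
  have hnΔle : ‖((W'.Δ : ℚ) : ℚ_[2])‖ ≤ 1 := by
    rw [hnΔ]; exact pow_le_one₀ (by norm_num) (by norm_num)
  /- Step 1: `x₀` (a root of `Ψ₃`), `y₀` (on the curve), both `2`-integral, and `u₁`
  (`u₁¹² = Δ`) in `ℚ̄₂`; norms of `2, 3, 7`. -/
  set φA : ℚ →+* PadicAlgCl 2 := algebraMap ℚ (PadicAlgCl 2) with hφA
  have hnormA : ∀ r : ℚ, ‖φA r‖ = ‖(r : ℚ_[2])‖ := norm_algebraMap_padicAlgCl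
  have h2A : ‖(2 : PadicAlgCl 2)‖ = 2⁻¹ := norm_two_padicAlgCl_two
  have h3A : ‖(3 : PadicAlgCl 2)‖ = 1 := by
    have h := PadicAlgCl.norm_natCast_of_not_dvd (p := 2) (n := 3) (by norm_num)
    push_cast at h
    exact h
  have h7A : ‖(7 : PadicAlgCl 2)‖ = 1 := by
    have h := PadicAlgCl.norm_natCast_of_not_dvd (p := 2) (n := 7) (by norm_num)
    push_cast at h
    exact h
  have h2Ale : ‖(2 : PadicAlgCl 2)‖ ≤ 1 := by rw [h2A]; norm_num
  obtain ⟨hna₁, hna₂, hna₃, -, -, -, -, -, -⟩ := norm_coeff_padicAlgCl_le_one W' (p := 2)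
  obtain ⟨x₀, y₀, hnx₀, hny₀, hΨx₀, hy₀eq⟩ := exists_flexPoint_padicAlgCl_two W'
  have hΔA0 : φA W'.Δ ≠ 0 := (map_ne_zero φA).mpr hΔ0
  obtain ⟨u₁, hu₁⟩ := IsAlgClosed.exists_pow_nat_eq (φA W'.Δ) (by norm_num : 0 < 12)
  have hu₁0 : u₁ ≠ 0 := by
    intro h; rw [h, zero_pow (by norm_num)] at hu₁; exact hΔA0 hu₁.symm
  have hnu₁12 : ‖u₁‖ ^ 12 = ‖((W'.Δ : ℚ) : ℚ_[2])‖ := by rw [← norm_pow, hu₁, hnormA]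
  have hnu₁ : ‖u₁‖ ≤ 1 :=
    (pow_le_one_iff_of_nonneg (norm_nonneg _) (by norm_num : (12 : ℕ) ≠ 0)).mp (hnu₁12 ▸ hnΔle)
  have hu₁pos : 0 < ‖u₁‖ := norm_pos_iff.mpr hu₁0
  /- Step 2: the field `K = ℚ₂(x₀, y₀, u₁)`, finite over `ℚ₂`, and the comparison maps. -/
  set S : Set (PadicAlgCl 2) := {x₀, y₀, u₁} with hS
  set K : IntermediateField ℚ_[2] (PadicAlgCl 2) := IntermediateField.adjoin ℚ_[2] S with hKdef
  haveI hKfd : FiniteDimensional ℚ_[2] K := IntermediateField.finiteDimensional_adjoin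
      (fun x _ ↦ Algebra.IsIntegral.isIntegral x)
  have hx₀K : x₀ ∈ K := IntermediateField.subset_adjoin ℚ_[2] S (by simp [hS])
  have hy₀K : y₀ ∈ K := IntermediateField.subset_adjoin ℚ_[2] S (by simp [hS])
  have hu₁K : u₁ ∈ K := IntermediateField.subset_adjoin ℚ_[2] S (by simp [hS])
  set x₀K : K := ⟨x₀, hx₀K⟩ with hx₀Kdef
  set y₀K : K := ⟨y₀, hy₀K⟩ with hy₀Kdef
  set u₁K : K := ⟨u₁, hu₁K⟩ with hu₁Kdef
  have hcx : ((x₀K : K) : PadicAlgCl 2) = x₀ := rfl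
  have hcy : ((y₀K : K) : PadicAlgCl 2) = y₀ := rfl
  have hcu : ((u₁K : K) : PadicAlgCl 2) = u₁ := rfl
  set φQ : ℚ →+* K := algebraMap ℚ K with hφQ
  have hcoeQ : ∀ r : ℚ, ((φQ r : K) : PadicAlgCl 2) = φA r := fun r ↦ by
    rw [hφQ, hφA, eq_ratCast, eq_ratCast]; push_cast; rfl
  /- Step 3: the flex model `F₁ = (1, x₀, s, y₀) • (W' ⊗ K) = (A₁, 0, A₃, 0, 0)` over `K`. -/
  set W'K : WeierstrassCurve K := W'.map φQ with hW'K
  have hΔK : W'K.Δ ≠ 0 := by rw [hW'K, map_Δ]; exact (map_ne_zero φQ).mpr hΔ0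
  have heqK : y₀K ^ 2 + W'K.a₁ * x₀K * y₀K + W'K.a₃ * y₀K =
      x₀K ^ 3 + W'K.a₂ * x₀K ^ 2 + W'K.a₄ * x₀K + W'K.a₆ := by
    apply Subtype.ext
    simp only [hW'K, map_a₁, map_a₂, map_a₃, map_a₄, map_a₆]
    push_cast
    simp only [hcoeQ, hcx, hcy]
    exact hy₀eq
  have hΨK : 3 * x₀K ^ 4 + W'K.b₂ * x₀K ^ 3 + 3 * W'K.b₄ * x₀K ^ 2 + 3 * W'K.b₆ * x₀K
      + W'K.b₈ = 0 := by
    apply Subtype.ext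
    simp only [hW'K, map_b₂, map_b₄, map_b₆, map_b₈]
    push_cast
    simp only [hcoeQ, hcx]
    exact hΨx₀
  obtain ⟨-, sK, hsK, h₂, h₄, h₆⟩ := hAlg W'K x₀K y₀K hΔK heqK hΨK
  set C₁ : VariableChange K := ⟨1, x₀K, sK, y₀K⟩ with hC₁
  set F₁ : WeierstrassCurve K := C₁ • W'K with hF₁
  set A₁ : K := F₁.a₁ with hA₁
  set A₃ : K := F₁.a₃ with hA₃
  have hA₁e : A₁ = W'K.a₁ + 2 * sK := by
    rw [hA₁, hF₁, variableChange_a₁, hC₁, inv_one, Units.val_one, one_mul]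
  have hA₃e : A₃ = W'K.a₃ + x₀K * W'K.a₁ + 2 * y₀K := by
    rw [hA₃, hF₁, variableChange_a₃, hC₁, inv_one, Units.val_one, one_pow, one_mul]
  have hΔF : F₁.Δ = A₃ ^ 3 * (A₁ ^ 3 - 27 * A₃) := Δ_eq_of_flex F₁ h₂ h₄ h₆
  have hc₄F : F₁.c₄ = A₁ * (A₁ ^ 3 - 24 * A₃) := c₄_eq_of_flex F₁ h₂ h₄
  have hΔF' : F₁.Δ = W'K.Δ := by
    rw [hF₁, variableChange_Δ, hC₁, inv_one, Units.val_one, one_pow, one_mul]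
  have hc₄F' : F₁.c₄ = W'K.c₄ := by
    rw [hF₁, variableChange_c₄, hC₁, inv_one, Units.val_one, one_pow, one_mul]
  /- Step 4: integrality of `s, A₁, A₃`; the identities `Δ = A₃³(A₁³ − 27A₃)`,
  `c₄ = A₁(A₁³ − 24A₃)` read in `ℚ̄₂`. -/
  have hsA : ((sK : K) : PadicAlgCl 2) ^ 2 + φA W'.a₁ * sK - φA W'.a₂ - 3 * x₀ = 0 := by
    have h := congrArg (fun z : K ↦ (z : PadicAlgCl 2)) hsK
    simp only [hW'K, map_a₁, map_a₂] at h
    push_cast at h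
    simp only [hcoeQ, hcx] at h
    exact h
  have hns : ‖((sK : K) : PadicAlgCl 2)‖ ≤ 1 :=
    norm_le_one_of_quartic_eq_zero (c₄ := 1) (c₃ := φA W'.a₁) (c₂ := -(φA W'.a₂ + 3 * x₀))
      (c₁ := 0) (c₀ := 0) norm_one hna₁
      (by rw [norm_neg]; exact norm_add_le_one hna₂ (norm_mul_le_one h3A.le hnx₀))
      (by rw [norm_zero]; exact zero_le_one) (by rw [norm_zero]; exact zero_le_one)
      (by linear_combination ((sK : K) : PadicAlgCl 2) ^ 2 * hsA)
  have hA₁A : ((A₁ : K) : PadicAlgCl 2) = φA W'.a₁ + 2 * sK := by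
    rw [hA₁e, hW'K, map_a₁]; push_cast; rw [hcoeQ]; rfl
  have hA₃A : ((A₃ : K) : PadicAlgCl 2) = φA W'.a₃ + x₀ * φA W'.a₁ + 2 * y₀ := by
    rw [hA₃e, hW'K, map_a₁, map_a₃]; push_cast; rw [hcoeQ, hcoeQ, hcx, hcy]; rfl
  have hnA₁ : ‖((A₁ : K) : PadicAlgCl 2)‖ ≤ 1 := by
    rw [hA₁A]; exact norm_add_le_one hna₁ (norm_mul_le_one h2Ale hns)
  have hnA₃ : ‖((A₃ : K) : PadicAlgCl 2)‖ ≤ 1 := by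
    rw [hA₃A]
    exact norm_add_le_one (norm_add_le_one hna₃ (norm_mul_le_one hnx₀ hna₁))
      (norm_mul_le_one h2Ale hny₀)
  have hΔA : ((A₃ : K) : PadicAlgCl 2) ^ 3 *
      (((A₁ : K) : PadicAlgCl 2) ^ 3 - 27 * ((A₃ : K) : PadicAlgCl 2)) = φA W'.Δ := by
    have h : ((F₁.Δ : K) : PadicAlgCl 2) = φA W'.Δ := by rw [hΔF', hW'K, map_Δ, hcoeQ]
    rw [hΔF] at h
    push_cast at h
    exact h
  have hc₄A : ((A₁ : K) : PadicAlgCl 2) *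
      (((A₁ : K) : PadicAlgCl 2) ^ 3 - 24 * ((A₃ : K) : PadicAlgCl 2)) = φA W'.c₄ := by
    have h : ((F₁.c₄ : K) : PadicAlgCl 2) = φA W'.c₄ := by rw [hc₄F', hW'K, map_c₄, hcoeQ]
    rw [hc₄F] at h
    push_cast at h
    exact h
  /- Step 5: the flex inequalities `‖A₁‖¹² ≤ ‖Δ‖`, `‖A₃‖⁴ = ‖Δ‖` (and the refined one). -/
  obtain ⟨⟨h12, h4⟩, hpart2⟩ := hNorm h2A h3A ((A₁ : K) : PadicAlgCl 2)
    ((A₃ : K) : PadicAlgCl 2) hnA₁ hnA₃ (by rw [hΔA]; exact hΔA0)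
    (by rw [hΔA, hc₄A, hnormA, hnormA]; exact hpot)
  rw [hΔA, hnormA] at h12 h4
  rw [hΔA, hc₄A, hnormA, hnormA] at hpart2
  /- Step 6: `O = 𝒪_K`, a uniformiser `ϖ`, `2 ~ ϖᵉ`, `u₁ = w ϖᵏ`, `12k = de`. -/
  letI hOloc : IsLocalRing (padicCoeffRing K) := isLocalRing_padicCoeffRing K
  haveI hOdvr : IsDiscreteValuationRing (padicCoeffRing K) :=
    isDiscreteValuationRing_padicCoeffRing K
  obtain ⟨ϖ, hϖ⟩ := IsDiscreteValuationRing.exists_irreducible (padicCoeffRing K)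
  have hϖ0 : ((ϖ : padicCoeffRing K) : K) ≠ 0 := fun h ↦ hϖ.ne_zero (Subtype.ext h)
  have hϖA0 : (((ϖ : padicCoeffRing K) : K) : PadicAlgCl 2) ≠ 0 := fun h ↦
    hϖ0 (by exact_mod_cast h)
  have hϖlt : ‖(((ϖ : padicCoeffRing K) : K) : PadicAlgCl 2)‖ < 1 :=
    (mem_nonunits_padicCoeffRing_iff K ϖ).mp (mem_nonunits_iff.mpr hϖ.not_isUnit)
  have hϖpos : 0 < ‖(((ϖ : padicCoeffRing K) : K) : PadicAlgCl 2)‖ := norm_pos_iff.mpr hϖA0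
  set twoO : padicCoeffRing K := ⟨φQ 2, (mem_padicCoeffRing_iff K _).mpr
    (by rw [hcoeQ, map_ofNat]; exact h2Ale)⟩ with htwoO
  have htwoA : (((twoO : padicCoeffRing K) : K) : PadicAlgCl 2) = 2 := by
    show ((φQ 2 : K) : PadicAlgCl 2) = 2
    rw [hcoeQ, map_ofNat]
  have hpO0 : twoO ≠ 0 := by
    intro h
    have h1 : (((twoO : padicCoeffRing K) : K) : PadicAlgCl 2) = 0 := by rw [h]; rfl
    rw [htwoA] at h1
    exact two_ne_zero h1
  obtain ⟨e, v, hpe⟩ := IsDiscreteValuationRing.eq_unit_mul_pow_irreducible hpO0 hϖ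
  have hπe : ‖(((ϖ : padicCoeffRing K) : K) : PadicAlgCl 2)‖ ^ e = (2 : ℝ)⁻¹ := by
    have h : ‖(((twoO : padicCoeffRing K) : K) : PadicAlgCl 2)‖ =
        ‖(((v * ϖ ^ e : padicCoeffRing K) : K) : PadicAlgCl 2)‖ := by rw [hpe]
    rw [htwoA] at h
    push_cast at h
    rw [norm_mul, norm_pow, (isUnit_padicCoeffRing_iff K _).mp v.isUnit, one_mul, h2A] at h
    exact h.symm
  have he0 : 0 < e := by
    rcases Nat.eq_zero_or_pos e with h | h
    · rw [h, pow_zero] at hπe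
      norm_num at hπe
    · exact h
  set u₁O : padicCoeffRing K := ⟨u₁K, (mem_padicCoeffRing_iff K u₁K).mpr hnu₁⟩ with hu₁O
  have hu₁K0 : u₁K ≠ 0 := fun h ↦ hu₁0 (by rw [← hcu, h]; rfl)
  have hu₁O0 : u₁O ≠ 0 := fun h ↦ hu₁K0 (congrArg Subtype.val h)
  obtain ⟨k, w, hu₁k⟩ := IsDiscreteValuationRing.eq_unit_mul_pow_irreducible hu₁O0 hϖ
  have hw1 : ‖(((w : padicCoeffRing K) : K) : PadicAlgCl 2)‖ = 1 :=
    (isUnit_padicCoeffRing_iff K _).mp w.isUnit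
  have hu₁Kfac : u₁K = ((w : padicCoeffRing K) : K) * ((ϖ : padicCoeffRing K) : K) ^ k := by
    have h : ((u₁O : padicCoeffRing K) : K) = (((w * ϖ ^ k : padicCoeffRing K)) : K) := by
      rw [hu₁k]
    push_cast at h
    exact h
  have hnu₁ϖ : ‖u₁‖ = ‖(((ϖ : padicCoeffRing K) : K) : PadicAlgCl 2)‖ ^ k := by
    have h : ‖((u₁K : K) : PadicAlgCl 2)‖ = ‖((((w : padicCoeffRing K) : K) *
        ((ϖ : padicCoeffRing K) : K) ^ k : K) : PadicAlgCl 2)‖ := by rw [← hu₁Kfac]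
    push_cast at h
    rw [norm_mul, norm_pow, hw1, one_mul] at h
    exact h
  have hke : 12 * k = d * e := by
    have h : ‖(((ϖ : padicCoeffRing K) : K) : PadicAlgCl 2)‖ ^ (12 * k) =
        ‖(((ϖ : padicCoeffRing K) : K) : PadicAlgCl 2)‖ ^ (d * e) := by
      rw [mul_comm 12 k, pow_mul, ← hnu₁ϖ, hnu₁12, hnΔ, ← hπe, ← pow_mul, mul_comm e d]
    exact nat_eq_of_pow_eq hϖpos hϖlt h
  /- Step 7: the `O`-curve `V'' = (α, 0, β, 0, 0) = (ϖᵏ, 0, 0, 0) • F₁` and its comparison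
  with `W' ⊗ K`. -/
  set ϖK : K := ((ϖ : padicCoeffRing K) : K) with hϖK
  have hϖk0 : ϖK ^ k ≠ 0 := pow_ne_zero _ hϖ0
  have hnϖk : ‖((ϖK ^ k : K) : PadicAlgCl 2)‖ = ‖u₁‖ := by push_cast; rw [norm_pow, ← hnu₁ϖ]
  set α : K := (ϖK ^ k)⁻¹ * A₁ with hα
  set β : K := (ϖK ^ k)⁻¹ ^ 3 * A₃ with hβ
  have hnA₁le : ‖((A₁ : K) : PadicAlgCl 2)‖ ≤ ‖u₁‖ := by
    rw [← hnu₁12] at h12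
    exact (pow_le_pow_iff_left₀ (norm_nonneg _) (norm_nonneg _) (by norm_num)).mp h12
  have hnA₃eq : ‖((A₃ : K) : PadicAlgCl 2)‖ = ‖u₁‖ ^ 3 := by
    rw [← hnu₁12, show (12 : ℕ) = 3 * 4 from rfl, pow_mul] at h4
    exact (pow_left_inj₀ (norm_nonneg _) (by positivity) (by norm_num)).mp h4
  have hnαA₁ : ‖((α : K) : PadicAlgCl 2)‖ * ‖u₁‖ = ‖((A₁ : K) : PadicAlgCl 2)‖ := by
    rw [hα]; push_cast; rw [norm_mul, norm_inv, norm_pow, ← hnu₁ϖ]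
    field_simp
  have hnα : ‖((α : K) : PadicAlgCl 2)‖ ≤ 1 := by
    by_contra h
    have h' : ‖u₁‖ < ‖((α : K) : PadicAlgCl 2)‖ * ‖u₁‖ := lt_mul_left hu₁pos (not_le.mp h)
    rw [hnαA₁] at h'
    exact absurd hnA₁le (not_le.mpr h')
  have hnβ : ‖((β : K) : PadicAlgCl 2)‖ = 1 := by
    rw [hβ]; push_cast; rw [norm_mul, norm_pow, norm_inv, norm_pow, ← hnu₁ϖ, hnA₃eq]
    field_simp
  set αO : padicCoeffRing K := ⟨α, (mem_padicCoeffRing_iff K α).mpr hnα⟩ with hαO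
  set βO : padicCoeffRing K := ⟨β, (mem_padicCoeffRing_iff K β).mpr hnβ.le⟩ with hβO
  set V'' : WeierstrassCurve (padicCoeffRing K) := ⟨αO, 0, βO, 0, 0⟩ with hV''
  set πu : Kˣ := Units.mk0 ϖK hϖ0 with hπu
  set x₀O : padicCoeffRing K := ⟨x₀K, (mem_padicCoeffRing_iff K x₀K).mpr hnx₀⟩ with hx₀O
  set sO : padicCoeffRing K := ⟨sK, (mem_padicCoeffRing_iff K sK).mpr hns⟩ with hsO
  set y₀O : padicCoeffRing K := ⟨y₀K, (mem_padicCoeffRing_iff K y₀K).mpr hny₀⟩ with hy₀O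
  have hπuk : ((πu ^ k : Kˣ) : K) = ϖK ^ k := by rw [Units.val_pow_eq_pow_val, hπu, Units.val_mk0]
  have hπuki : (((πu ^ k)⁻¹ : Kˣ) : K) = (ϖK ^ k)⁻¹ := by rw [Units.val_inv_eq_inv_val, hπuk]
  have hcαO : ((αO : padicCoeffRing K) : K) = α := rfl
  have hV''K : V''.map (algebraMap (padicCoeffRing K) K) =
      (⟨πu ^ k, (x₀O : K), (sO : K), (y₀O : K)⟩ : VariableChange K) • W'K := by
    have hmul : (⟨πu ^ k, (x₀O : K), (sO : K), (y₀O : K)⟩ : VariableChange K) =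
        ⟨πu ^ k, 0, 0, 0⟩ * C₁ := by rw [hC₁, scale_mul_rst]
    rw [hmul, mul_smul, ← hF₁, scale_smul_flex F₁ h₂ h₄ h₆ (πu ^ k), hπuki]
    exact WeierstrassCurve.ext rfl rfl rfl rfl rfl
  /- Step 8: `coeff 4 [2]_{V''} = −7β` is a unit (`J = 4`); `coeff 2 [2]_{V''} = −α`. -/
  have h7u : IsUnit ((7 : padicCoeffRing K)) :=
    (isUnit_padicCoeffRing_iff K _).mpr h7A
  have hβu : IsUnit βO := (isUnit_padicCoeffRing_iff K _).mpr hnβ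
  have hunit4 : IsUnit (coeff 4 (V''.formalMul 2)) := by
    rw [WeierstrassCurve.coeff_four_formalMul_two]
    have h : V''.a₁ * V''.a₂ - 7 * V''.a₃ = -(7 * βO) := by rw [hV'']; ring
    rw [h]
    exact (h7u.mul hβu).neg
  have hcoeff2 : coeff 2 (V''.formalMul 2) = -αO := by
    rw [WeierstrassCurve.coeff_two_formalMul_two]
  have hΔ' : ((2 : ℕ) : ℤ) ∣ minimalDiscriminantInt W' := by exact_mod_cast hΔ
  have hc₄' : ((2 : ℕ) : ℤ) ∣ (integralModelInt W').c₄ := by exact_mod_cast hc₄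
  have hπe' : ‖((πu : K) : PadicAlgCl 2)‖ ^ e = ((2 : ℕ) : ℝ)⁻¹ := by
    rw [hπu, Units.val_mk0]; push_cast; exact hπe
  rcases le_or_gt d 15 with hd15 | hd16
  · /- Step 9: `v₂(Δ_min) ≤ 15`: the sharp ender with `J = 4`, `3k < 4e ⟸ 36k = 3de ≤ 45e`. -/
    refine padicNorm_le_one_of_neronLattice_eq_smul_periodLattice_of_semistableTwist_sharp hf hL'
      hq hq' hΔ' hc₄' K πu hπe' x₀O sO y₀O V'' hV''K ⟨4, by norm_num, hunit4, ?_⟩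
    have h1 : 3 * (12 * k) ≤ 45 * e := by
      rw [hke]; calc 3 * (d * e) = (3 * d) * e := by ring
        _ ≤ 45 * e := Nat.mul_le_mul_right e (by omega)
    omega
  · /- Step 10: `v₂(Δ_min) ≥ 16`: Kraus gives `v₂(c₄) ≤ 7`, so `‖A₁‖⁴ = ‖c₄‖`, and the vertex
    `(2, v(α))` of `[2]_{V''}` satisfies `4(k + v) = v₂(c₄)e < 8e`. -/
    obtain ⟨hc₄0, hc7⟩ := padicValInt_c₄_le_seven_of_le W' (by omega)
    set c : ℕ := padicValInt 2 (integralModelInt W').c₄ with hc_def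
    have hnc₄ : ‖((W'.c₄ : ℚ) : ℚ_[2])‖ = (2⁻¹ : ℝ) ^ c := by
      have h := norm_c₄_eq_inv_pow_padicValInt W' (p := 2) hc₄0
      push_cast at h
      exact h
    have hA₁4 : ‖((A₁ : K) : PadicAlgCl 2)‖ ^ 4 = (2⁻¹ : ℝ) ^ c := by
      rw [← hnc₄]
      apply hpart2
      · rw [hnΔ]; exact pow_le_pow_of_le_one (by norm_num) (by norm_num) (by omega)
      · rw [hnc₄]; exact pow_le_pow_of_le_one (by norm_num) (by norm_num) hc7
    have hA₁pos : 0 < ‖((A₁ : K) : PadicAlgCl 2)‖ := by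
      refine (norm_nonneg _).lt_of_ne fun h ↦ ?_
      rw [← h, zero_pow four_ne_zero] at hA₁4
      exact absurd hA₁4.symm (pow_pos (by norm_num) c).ne'
    have hαO0 : αO ≠ 0 := by
      intro h
      have h1 : (((αO : padicCoeffRing K) : K) : PadicAlgCl 2) = 0 := by rw [h]; rfl
      have h3 := hnαA₁
      rw [hcαO] at h1
      rw [h1, norm_zero, zero_mul] at h3
      exact absurd h3.symm hA₁pos.ne'
    obtain ⟨v', wα, hαv⟩ := IsDiscreteValuationRing.eq_unit_mul_pow_irreducible hαO0 hϖ
    have hnαv : ‖((α : K) : PadicAlgCl 2)‖ =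
        ‖(((ϖ : padicCoeffRing K) : K) : PadicAlgCl 2)‖ ^ v' := by
      have h : ((αO : padicCoeffRing K) : K) = (((wα * ϖ ^ v' : padicCoeffRing K)) : K) := by
        rw [hαv]
      push_cast at h
      have h' : ‖((α : K) : PadicAlgCl 2)‖ = ‖((((wα : padicCoeffRing K) : K) *
          ((ϖ : padicCoeffRing K) : K) ^ v' : K) : PadicAlgCl 2)‖ := by rw [← h]
      push_cast at h'
      rw [norm_mul, norm_pow, (isUnit_padicCoeffRing_iff K _).mp wα.isUnit, one_mul] at h'
      exact h'
    have hkv : 4 * (k + v') = c * e := by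
      have h : ‖(((ϖ : padicCoeffRing K) : K) : PadicAlgCl 2)‖ ^ (4 * (k + v')) =
          ‖(((ϖ : padicCoeffRing K) : K) : PadicAlgCl 2)‖ ^ (c * e) := by
        rw [mul_comm 4, pow_mul, pow_add, ← hnu₁ϖ, ← hnαv, mul_comm, hnαA₁, hA₁4, ← hπe,
          ← pow_mul, mul_comm e c]
      exact nat_eq_of_pow_eq hϖpos hϖlt h
    refine padicNorm_le_one_of_neronLattice_eq_smul_periodLattice_of_semistableTwist_vertex hf hL'
      hq hq' hΔ' hc₄' K πu hπe' x₀O sO y₀O V'' hV''K ⟨4, by norm_num, hunit4⟩ (j := 2) (v := v')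
      (by norm_num) ?_ ?_
    · rw [hcoeff2, hπu, Units.val_mk0]
      push_cast
      rw [norm_neg, hcαO]
      exact hnαv.ge
    · have h1 : 4 * (k + v') ≤ 4 * (2 * e) - e := by
        rw [hkv]
        have : c * e ≤ 7 * e := Nat.mul_le_mul_right e hc7
        omega
      omega

end Summit.ABC.ABC.Theorems
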